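import Mathlib
import Summits.NavierStokesRegularity.NavierStokesRegularity.Theorems.EulerZoomLiouvillePowerGaugeEulerLiouvilleCondenserGradientRiccati

/-!
# (B6) A PRESSURE RIDGE NEEDS MOMENTUM FLUX (line «ballistic-faces» of ns-idea-11 g7, stub `Sig.ridgeNeedsMomentumFlux`)

Width piece for crux `EulerZoomLiouville.PowerGaugeEulerLiouville` (stmt-NavierStokesRegularity-19832), by name under LEAD 19832
(ns-typeII-p2 g13); seat ns-ezl-w2 g4, `--supports stmt-NavierStokesRegularity-19832 --as helper`.  Text = ns-idea-11 g7's
`Cruxes/PowerGaugeEulerLiouville/BallisticFaces.lean` REV3 Prop `Sig.ridgeNeedsMomentumFlux` binder-for-binder (`E3` spelled out).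

For a self-similar Euler profile `(V, P′)` (CIV (3.3), centre `0`, `W = γy + V`), the profile equation solved for the pressure gradient,
`∇P′ = −(1−γ)V − DV·W` (`Condenser.gradient_pressure_eq`), bounds the pressure Lipschitz constant on a segment by the MOMENTUM FLUX there:
if `|1−γ|‖V w‖ + ‖DV(w)‖·‖W w‖ ≤ M` on `[y, z]` then `|P′ y − P′ z| ≤ M‖y − z‖` (mean value theorem, `Convex.norm_image_sub_le_of_norm_fderiv_le`).
Reading (the card): the EULERIAN complement to pressure capacity — a `κr²`-ridge of diameter `d` needs momentum flux `≥ (κ−ε)r²/d` across its boundary layer in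
every direction, the radial one included.

* `norm_gradient_pressure_le` — `‖∇P′ w‖ ≤ |1−γ|‖V w‖ + ‖DV(w)‖·‖W w‖`;
* **`ridgeNeedsMomentumFlux_of`**, `ridgeNeedsMomentumFlux` — the statement, pointwise and as the Sig text.

HONEST FRAMING: calculus for HYPOTHETICAL self-similar Euler profiles (MODEL lattice of the crux class); nothing here proves the crux E (19832 OPEN),
any door Target, or Navier–Stokes regularity. [cite: ConstantinIgnatovaVicol2026Putative, §3.1.1 eq. (3.3); folklore (mean value theorem)]
-/

noncomputable section

open Set Filter Topology Metric Function InnerProductSpace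
open scoped RealInnerProductSpace

set_option linter.dupNamespace false

namespace Summit.NavierStokesRegularity.NavierStokesRegularity.Theorems.PowerGaugeEulerLiouville.Ballistic

open Literature.Analysis Literature.Analysis.FluidPDE
open Summit.NavierStokesRegularity.NavierStokesRegularity.Theorems.PowerGaugeEulerLiouville

variable {γ : ℝ} {V : EuclideanSpace ℝ (Fin 3) → EuclideanSpace ℝ (Fin 3)} {P' : EuclideanSpace ℝ (Fin 3) → ℝ}

/-- **`‖∇P′ w‖ ≤ |1−γ|‖V w‖ + ‖DV(w)‖·‖W w‖`** (profile equation solved for `∇P′`). [cite: ConstantinIgnatovaVicol2026Putative, §3.1.1 eq. (3.3)] -/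
theorem norm_gradient_pressure_le (hprof : IsSelfSimilarEulerProfile γ 0 V P') (w : EuclideanSpace ℝ (Fin 3)) :
    ‖gradient P' w‖ ≤ |1 - γ| * ‖V w‖ + ‖fderiv ℝ V w‖ * ‖selfSimilarTransport γ 0 V w‖ := by
  have h := congrFun (Condenser.gradient_pressure_eq hprof) w
  simp only [Pi.neg_apply, Pi.add_apply, Pi.smul_apply] at h
  rw [h, norm_neg]
  calc ‖(1 - γ) • V w + fderiv ℝ V w (selfSimilarTransport γ 0 V w)‖
      ≤ ‖(1 - γ) • V w‖ + ‖fderiv ℝ V w (selfSimilarTransport γ 0 V w)‖ := norm_add_le _ _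
    _ ≤ |1 - γ| * ‖V w‖ + ‖fderiv ℝ V w‖ * ‖selfSimilarTransport γ 0 V w‖ := by
        rw [norm_smul, Real.norm_eq_abs]
        exact add_le_add le_rfl (ContinuousLinearMap.le_opNorm _ _)

/-- **(B6) A PRESSURE RIDGE NEEDS MOMENTUM FLUX**: if `|1−γ|‖V‖ + ‖DV‖‖W‖ ≤ M` on the segment `[y, z]` then `|P′ y − P′ z| ≤ M‖y − z‖`.
[cite: ConstantinIgnatovaVicol2026Putative, §3.1.1 eq. (3.3); folklore (mean value theorem)] -/
theorem ridgeNeedsMomentumFlux_of (hprof : IsSelfSimilarEulerProfile γ 0 V P') (y z : EuclideanSpace ℝ (Fin 3)) {M : ℝ}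
    (hM : ∀ w ∈ segment ℝ y z, |1 - γ| * ‖V w‖ + ‖fderiv ℝ V w‖ * ‖selfSimilarTransport γ 0 V w‖ ≤ M) :
    |P' y - P' z| ≤ M * ‖y - z‖ := by
  have hPd : Differentiable ℝ P' := hprof.contDiff_pressure.differentiable one_ne_zero
  have hbound : ∀ w ∈ segment ℝ y z, ‖fderiv ℝ P' w‖ ≤ M := fun w hw => by
    -- `‖DP′(w)‖ = ‖∇P′ w‖` (Riesz; cf. `PlanarEnergyAPriori.norm_fderiv_eq_norm_gradient`)
    have e : ‖fderiv ℝ P' w‖ = ‖gradient P' w‖ := by rw [gradient, LinearIsometryEquiv.norm_map]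
    rw [e]
    exact (norm_gradient_pressure_le hprof w).trans (hM w hw)
  have h := Convex.norm_image_sub_le_of_norm_fderiv_le (fun w _ => hPd w) hbound (convex_segment y z)
    (right_mem_segment ℝ y z) (left_mem_segment ℝ y z)
  rw [Real.norm_eq_abs] at h
  exact h

/-- **`Sig.ridgeNeedsMomentumFlux`, binder-for-binder** (ns-idea-11 g7, `BallisticFaces.lean` REV3 (B6); `E3 = EuclideanSpace ℝ (Fin 3)` spelled out).
[cite: ConstantinIgnatovaVicol2026Putative, §3.1.1 eq. (3.3); folklore (mean value theorem)] -/
theorem ridgeNeedsMomentumFlux :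
    ∀ (γ : ℝ) (V : EuclideanSpace ℝ (Fin 3) → EuclideanSpace ℝ (Fin 3)) (P' : EuclideanSpace ℝ (Fin 3) → ℝ),
      IsSelfSimilarEulerProfile γ 0 V P' →
      ∀ (y z : EuclideanSpace ℝ (Fin 3)) (M : ℝ),
        (∀ w ∈ segment ℝ y z, |1 - γ| * ‖V w‖ + ‖fderiv ℝ V w‖ * ‖selfSimilarTransport γ 0 V w‖ ≤ M) →
          |P' y - P' z| ≤ M * ‖y - z‖ :=
  fun _ _ _ hprof y z _ hM => ridgeNeedsMomentumFlux_of hprof y z hM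

end Summit.NavierStokesRegularity.NavierStokesRegularity.Theorems.PowerGaugeEulerLiouville.Ballistic

end
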